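import Literature.Topology.FourManifolds.LatticeFormsVanDerBlijMatrix
import Literature.Topology.FourManifolds.LatticeFormsProofs
import HarnessLib

/-!
# van der Blij's lemma: `8 ∣ σ(Q)` for an even unimodular lattice
(discharge of `LinearMap.BilinForm.eight_dvd_signature_of_isEven` of `LatticeForms.lean`)

Trunk T-4MAN (`FourManifolds`); companion of `LatticeForms.lean`, `LatticeFormsProofs.lean`,
`LatticeFormsSylvester.lean`, `LatticeFormsVanDerBlijMatrix.lean`.

**Theorem** (van der Blij 1959; Serre, *A Course in Arithmetic*, Ch. V §2.1 Thm. 2 Cor. 1;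
Milnor–Husemoller, *Symmetric Bilinear Forms*, Ch. II §5). The signature of an even (type II)
symmetric unimodular form on a lattice is divisible by `8`.

The named fact `LinearMap.BilinForm.eight_dvd_signature_of_isEven` (stated in `LatticeForms.lean`
with the citation of Milnor–Husemoller II (5.1)–(5.2) and Serre V Thm. 2 Cor. 1) is discharged
here (`eight_dvd_signature_of_isEven_holds`) by transport to coordinates: a basis `b` of the free
module `V` of rank `n` gives an isometry `Q ≅ ᵗx G y` on `ℤⁿ` (`G` the Gram matrix, Mathlib
`LinearMap.BilinForm.isometryEquivOfCompLinearEquiv`), under which unimodularity becomes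
`det G = ±1` (`isUnimodular_iff_isUnit_det_holds`), evenness and the signature are preserved
(`isEven_iff_of_equivalent`, `signature_eq_of_equivalent`), and the matrix statement is
`Literature.Topology.FourManifolds.eight_dvd_sigPos_sub_sigNeg` (`LatticeFormsVanDerBlijMatrix.lean`), proved along
Serre's Remark 2 to V §2.1 Thm. 2: invariance of the Hasse–Witt products `εₚ` (Witt's chain
equivalence, IV §1.4–§2.1), `εₚ = 1` for odd `p` and the `2`-adic evaluation from integral
`p`-adic frames (V §1.3.6), Hilbert's product formula (III §2.1, IV §3.1), and Sylvester's law on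
the lattice.

## References

* J.-P. Serre, *A Course in Arithmetic*, GTM 7, Springer 1973, Ch. V §2.1 Thm. 2, Cor. 1 and
  Remark 2 (PDF p. 50). [Serre1973]
* J. Milnor, D. Husemoller, *Symmetric Bilinear Forms*, Springer 1973, Ch. II §5,
  (5.1)–(5.2). [MilnorHusemoller1973]
* F. van der Blij, *An invariant of quadratic forms mod 8*, Indag. Math. 21 (1959), 291–293.
-/

noncomputable section

open Module

namespace LinearMap.BilinForm

variable {V : Type*} [AddCommGroup V] [Module ℤ V] (Q : LinearMap.BilinForm ℤ V)

/-- **van der Blij's lemma** (discharge of the named fact `eight_dvd_signature_of_isEven`): the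
signature of an even symmetric unimodular form on a lattice (finitely generated free `ℤ`-module)
is divisible by `8`. Serre, *A Course in Arithmetic*, Ch. V §2.1 Thm. 2 Cor. 1 ("if `E` is of
type II, `τ(E) ≡ 0 (mod 8)`"); Milnor–Husemoller (1973) II (5.1)–(5.2). Proof: transport along a
basis to an even symmetric integer Gram matrix of determinant `±1` and apply
`Literature.Topology.FourManifolds.eight_dvd_sigPos_sub_sigNeg` (Serre's Remark 2: product formula for the Hasse
invariants). [cite: Serre1973, Ch. V §2.1 Thm. 2 Cor. 1] [cite: MilnorHusemoller1973, II (5.1)–(5.2)] -/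
theorem eight_dvd_signature_of_isEven_holds : Q.eight_dvd_signature_of_isEven := by
  intro _ _ hs hu he
  -- coordinates
  set n := finrank ℤ V with hn
  let b : Basis (Fin n) ℤ V := Module.finBasis ℤ V
  let e : (Fin n → ℤ) ≃ₗ[ℤ] V := b.equivFun.symm
  set B' : LinearMap.BilinForm ℤ (Fin n → ℤ) :=
    Q.comp (e : (Fin n → ℤ) →ₗ[ℤ] V) (e : (Fin n → ℤ) →ₗ[ℤ] V) with hB'
  have hequiv : Q.Equivalent B' := ⟨isometryEquivOfCompLinearEquiv Q e⟩
  set G : Matrix (Fin n) (Fin n) ℤ := BilinForm.toMatrix' B' with hG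
  have hGB : Matrix.toBilin' G = B' := Matrix.toBilin'_toMatrix' B'
  -- hypotheses in coordinates
  have hB's : B'.IsSymm := ⟨fun x y => by simp only [hB', comp_apply]; exact hs.eq _ _⟩
  have hGs : G.IsSymm := by
    refine Matrix.isSymm_toBilin'_iff_isSymm.mp ?_
    rw [hGB]; exact hB's
  have hu' : B'.IsUnimodular := isUnimodular_of_equivalent hequiv hu
  have hdet : IsUnit G.det := by
    have h := (isUnimodular_iff_isUnit_det_holds B' (Pi.basisFun ℤ (Fin n))).mp hu'
    rwa [LinearMap.BilinForm.toMatrix_basisFun] at h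
  have he' : B'.IsEven := (isEven_iff_of_equivalent hequiv).mp he
  have hev : ∀ x, Even (Matrix.toBilin' G x x) := fun x => by rw [hGB]; exact he' x
  -- the matrix statement, transported back
  have h8 := Literature.Topology.FourManifolds.eight_dvd_sigPos_sub_sigNeg hGs hdet hev
  rw [hGB] at h8
  rw [signature_eq_of_equivalent hequiv]
  exact h8

end LinearMap.BilinForm
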